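import Summits.SmoothPoincare4.SmoothPoincare4.Theorems.SoloInformedPretzelSurgeryTietze17
import Summits.SmoothPoincare4.SmoothPoincare4.Theorems.SoloInformedBinaryIcosahedralOrder

/-!
# `|π₁(S³₁₇(P(-2,3,7)))| = 2040` from nine word identities (product-structure glue)

`SoloInformedPretzelSurgeryQuotients` proves `ρ17 : G17 = π₁(S³₁₇(P(-2,3,7))) → ℤ/17 × SL(2,𝔽₅)` onto and
`bijective_ρ17_of_card_le : [Finite G17] → Nat.card G17 ≤ 2040 → Bijective ρ17`, leaving the UPPER bound on the
order (classically a coset enumeration, `work/s110`) as the one externally certified input of (L2).  This file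
replaces that opaque input by nine explicit identities among words of length `≤ 17` in the Wirtinger generators,
and proves — purely structurally, in the kernel — that they force `Finite G17`, `Nat.card G17 = 2040` and
`G17 ≃* ℤ/17 × SL(2,𝔽₅)`:

* `x = a₀a₀a₁⁻¹a₂⁻¹`, `y = a₀a₃⁻¹`, `z = a₂a₄⁻¹` satisfy the binary icosahedral relations `x² = y³ = z⁵ = xyz`
  (`relX`, `relY`, `relZ`), so `K = ⟨x, y, z⟩` is an image of `⟨2,3,5⟩`, of order `≤ 120`
  (`BinaryIcosahedralOrder.card_le`, kernel-certified in this programme);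
* the meridian `μ = a₉` conjugates `x, y, z` into words in `x, y, z` (`conjX`, `conjY`, `conjZ`), so `μKμ⁻¹ ≤ K`;
* `μ¹⁷ = yz⁻¹x ∈ K` (`pow17`), whence also `μ⁻¹Kμ ≤ K` and `⟨μ⟩K = {μⁿk : n < 17, k ∈ K}` is closed under
  left multiplication by `μ^{±1}` and by `K`;
* `a₀ = yμ` and `a₈ = xy⁻¹z⁻¹μ` (`arc0`, `arc8`), and `a₀, a₈, a₉` generate `G17` (`σ17_surjective`, the Tietze
  certificate of `SoloInformedPretzelSurgeryTietze17`), so `G17 = ⟨μ⟩K` has at most `17 · 120 = 2040` elements.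

The nine identities hold in `G17` (each is an identity between elements whose `ρ17`-images agree, `nine_ρ17`, and
`ρ17` is injective by the GAP/ACE coset enumeration of (L2)); they are exactly the word problems a future kernel
certificate has to fill.  Their minimal *homological* filling areas in the Cayley complex of `ℤ/17 × SL(2,𝔽₅)`
(`2040` vertices, Wirtinger squares and the length-`41` surgery cells) were measured by LP (`work/s111`): e.g.
`129` (`arc0`), `541`–`859` (the conjugation identities), each `≈ 30 ×` the number of surgery cells used; the
glued minimal 2-chains are surfaces of genus `≈ 30`, not discs, so van Kampen areas are larger still — which is
why this file states the identities as hypotheses instead of replaying `~10⁵` rewriting steps.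
-/

namespace Summit.SmoothPoincare4.SmoothPoincare4.Theorems
namespace PretzelSurgery

open Literature.Algebra.Homology.RelationModule

/-- `x = a₀a₀a₁⁻¹a₂⁻¹` (maps to `(0, X)` with `X` of order `4` in `SL(2,𝔽₅)`). -/
def xI : G17 := g17 0 * g17 0 * (g17 1)⁻¹ * (g17 2)⁻¹
/-- `y = a₀a₃⁻¹` (maps to `(0, Y)`, `Y` of order `6`). -/
def yI : G17 := g17 0 * (g17 3)⁻¹
/-- `z = a₂a₄⁻¹` (maps to `(0, Z)`, `Z` of order `10`, `XYZ = -1`). -/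
def zI : G17 := g17 2 * (g17 4)⁻¹
/-- The meridian `μ = a₉` (`mu9`). -/
def mu9 : G17 := g17 9

/-- The nine word identities (all true in `G17`; see the module docstring). -/
structure NineIdentities : Prop where
  /-- `x² = xyz`. -/
  relX : xI ^ 2 = xI * yI * zI
  /-- `y³ = xyz`. -/
  relY : yI ^ 3 = xI * yI * zI
  /-- `z⁵ = xyz`. -/
  relZ : zI ^ 5 = xI * yI * zI
  /-- `μxμ⁻¹ = yxy⁻¹`. -/
  conjX : mu9 * xI * mu9⁻¹ = yI * xI * yI⁻¹
  /-- `μyμ⁻¹ = xzy⁻¹z⁻¹`. -/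
  conjY : mu9 * yI * mu9⁻¹ = xI * zI * yI⁻¹ * zI⁻¹
  /-- `μzμ⁻¹ = yz⁻¹`. -/
  conjZ : mu9 * zI * mu9⁻¹ = yI * zI⁻¹
  /-- `μ¹⁷ = yz⁻¹x`. -/
  pow17 : mu9 ^ 17 = yI * zI⁻¹ * xI
  /-- `a₀ = yμ` (equivalently `a₃ = a₉`). -/
  arc0 : g17 0 = yI * mu9
  /-- `a₈ = xy⁻¹z⁻¹μ`. -/
  arc8 : g17 8 = xI * yI⁻¹ * zI⁻¹ * mu9

/-- Sanity check: the nine identities hold after `ρ17` (so, `ρ17` being injective by (L2), they hold in `G17`). -/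
theorem nine_ρ17 :
    ρ17 xI ^ 2 = ρ17 xI * ρ17 yI * ρ17 zI ∧ ρ17 yI ^ 3 = ρ17 xI * ρ17 yI * ρ17 zI ∧
    ρ17 zI ^ 5 = ρ17 xI * ρ17 yI * ρ17 zI ∧ ρ17 mu9 * ρ17 xI * (ρ17 mu9)⁻¹ = ρ17 yI * ρ17 xI * (ρ17 yI)⁻¹ ∧
    ρ17 mu9 * ρ17 yI * (ρ17 mu9)⁻¹ = ρ17 xI * ρ17 zI * (ρ17 yI)⁻¹ * (ρ17 zI)⁻¹ ∧
    ρ17 mu9 * ρ17 zI * (ρ17 mu9)⁻¹ = ρ17 yI * (ρ17 zI)⁻¹ ∧ ρ17 mu9 ^ 17 = ρ17 yI * (ρ17 zI)⁻¹ * ρ17 xI ∧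
    ρ17 (g17 0) = ρ17 yI * ρ17 mu9 ∧ ρ17 (g17 8) = ρ17 xI * (ρ17 yI)⁻¹ * (ρ17 zI)⁻¹ * ρ17 mu9 := by
  simp only [xI, yI, zI, mu9, g17, map_mul, map_inv, ρ17_of]
  decide +kernel

/-- The binary icosahedral presentation `⟨2,3,5⟩ = ⟨x, y, z | x² = y³ = z⁵ = xyz⟩`. -/
abbrev B235 : Type := PresentedGroup (binaryTriangleRels 2 3 5)

/-- The generator assignment `x ↦ x, y ↦ y, z ↦ z` of `⟨2,3,5⟩` into `G17`. -/
def icoGen : Fin 3 → G17 := ![xI, yI, zI]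

/-- Under `relX, relY, relZ` the relators of `⟨2,3,5⟩` are killed. -/
theorem lift_icoGen (h : NineIdentities) : ∀ r ∈ binaryTriangleRels 2 3 5, FreeGroup.lift icoGen r = 1 := by
  rintro r ⟨i, rfl⟩
  fin_cases i
  · simp only [powRelWord, xyzWord, triExp, map_mul, map_inv, map_pow, FreeGroup.lift_apply_of, icoGen]
    simp only [Fin.zero_eta, Matrix.cons_val_zero, Matrix.cons_val_one, Matrix.cons_val, mul_inv_eq_one]
    exact h.relX
  · simp only [powRelWord, xyzWord, triExp, map_mul, map_inv, map_pow, FreeGroup.lift_apply_of, icoGen]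
    simp only [Matrix.cons_val_zero, Fin.mk_one, Matrix.cons_val_one, Matrix.cons_val, mul_inv_eq_one]
    exact h.relY
  · simp only [powRelWord, xyzWord, triExp, map_mul, map_inv, map_pow, FreeGroup.lift_apply_of, icoGen]
    simp only [Matrix.cons_val_zero, Matrix.cons_val_one, Matrix.cons_val, Fin.reduceFinMk, mul_inv_eq_one]
    exact h.relZ

/-- `ψ : ⟨2,3,5⟩ →* G17` (`psi235`). -/
def psi235 (h : NineIdentities) : B235 →* G17 := PresentedGroup.toGroup (lift_icoGen h)

/-- `ψ = psi235` on generators. -/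
theorem psi235_of (h : NineIdentities) (i : Fin 3) : psi235 h (PresentedGroup.of i) = icoGen i := PresentedGroup.toGroup.of _

/-- **Main theorem.** The nine identities force `|G17| = 2040`, and then `ρ17` is an isomorphism. -/
theorem finite_and_card_of_nine (h : NineIdentities) : Finite G17 ∧ Nat.card G17 ≤ 2040 := by
  -- `K = ψ(⟨2,3,5⟩) ∋ x, y, z`, finite of order `≤ 120`
  set K : Subgroup G17 := (psi235 h).range with hKdef
  have hx : xI ∈ K := ⟨PresentedGroup.of 0, psi235_of h 0⟩
  have hy : yI ∈ K := ⟨PresentedGroup.of 1, psi235_of h 1⟩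
  have hz : zI ∈ K := ⟨PresentedGroup.of 2, psi235_of h 2⟩
  haveI : Finite B235 := BinaryIcosahedralOrder.finite
  haveI hKfin : Finite K := Finite.of_surjective _ (psi235 h).rangeRestrict_surjective
  have hKcard : Nat.card K ≤ 120 :=
    (Nat.card_le_card_of_surjective _ (psi235 h).rangeRestrict_surjective).trans BinaryIcosahedralOrder.card_le
  -- `μ K μ⁻¹ ≤ K`
  have hconj : ∀ k ∈ K, mu9 * k * mu9⁻¹ ∈ K := by
    have hgen : ∀ i : Fin 3, (PresentedGroup.of i : B235) ∈ K.comap ((MulAut.conj mu9).toMonoidHom.comp (psi235 h)) := by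
      intro i
      simp only [Subgroup.mem_comap, MonoidHom.coe_comp, MulEquiv.coe_toMonoidHom, Function.comp_apply,
        MulAut.conj_apply, psi235_of, icoGen]
      fin_cases i
      · simp only [Fin.zero_eta, Matrix.cons_val_zero, h.conjX]
        exact K.mul_mem (K.mul_mem hy hx) (K.inv_mem hy)
      · simp only [Fin.mk_one, Matrix.cons_val_one, Matrix.cons_val_zero, h.conjY]
        exact K.mul_mem (K.mul_mem (K.mul_mem hx hz) (K.inv_mem hy)) (K.inv_mem hz)
      · simp only [Fin.reduceFinMk, Matrix.cons_val, h.conjZ]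
        exact K.mul_mem hy (K.inv_mem hz)
    rintro k ⟨b, rfl⟩
    have hb := PresentedGroup.generated_by _ _ hgen b
    simpa only [Subgroup.mem_comap, MonoidHom.coe_comp, MulEquiv.coe_toMonoidHom, Function.comp_apply,
      MulAut.conj_apply] using hb
  have hconj_pow : ∀ n : ℕ, ∀ k ∈ K, mu9 ^ n * k * (mu9 ^ n)⁻¹ ∈ K := by
    intro n
    induction n with
    | zero => intro k hk; simpa using hk
    | succ n ih =>
      intro k hk
      have e : mu9 ^ (n + 1) * k * (mu9 ^ (n + 1))⁻¹ = mu9 * (mu9 ^ n * k * (mu9 ^ n)⁻¹) * mu9⁻¹ := by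
        rw [pow_succ']; group
      rw [e]; exact hconj _ (ih k hk)
  have h17 : mu9 ^ 17 ∈ K := by rw [h.pow17]; exact K.mul_mem (K.mul_mem hy (K.inv_mem hz)) hx
  -- `μ⁻¹ K μ ≤ K`, using `μ⁻¹ = μ¹⁶ (μ¹⁷)⁻¹`
  have hconj' : ∀ k ∈ K, mu9⁻¹ * k * mu9 ∈ K := by
    intro k hk
    have e : mu9⁻¹ * k * mu9 = mu9 ^ 16 * ((mu9 ^ 17)⁻¹ * k * mu9 ^ 17) * (mu9 ^ 16)⁻¹ := by group
    rw [e]; exact hconj_pow 16 _ (K.mul_mem (K.mul_mem (K.inv_mem h17) hk) h17)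
  have hconj'_pow : ∀ n : ℕ, ∀ k ∈ K, (mu9 ^ n)⁻¹ * k * mu9 ^ n ∈ K := by
    intro n
    induction n with
    | zero => intro k hk; simpa using hk
    | succ n ih =>
      intro k hk
      have e : (mu9 ^ (n + 1))⁻¹ * k * mu9 ^ (n + 1) = mu9⁻¹ * ((mu9 ^ n)⁻¹ * k * mu9 ^ n) * mu9 := by
        rw [pow_succ]; group
      rw [e]; exact hconj' _ (ih k hk)
  -- the candidate normal form `μⁿ k`
  let P : G17 → Prop := fun g => ∃ n : ℕ, ∃ k ∈ K, g = mu9 ^ n * k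
  have P1 : P 1 := ⟨0, 1, K.one_mem, by simp⟩
  have Pmu9 : ∀ g, P g → P (mu9 * g) := by
    rintro g ⟨n, k, hk, rfl⟩; exact ⟨n + 1, k, hk, by rw [pow_succ']; group⟩
  have Pmu9' : ∀ g, P g → P (mu9⁻¹ * g) := by
    rintro g ⟨n, k, hk, rfl⟩
    refine ⟨n + 16, (mu9 ^ 17)⁻¹ * k, K.mul_mem (K.inv_mem h17) hk, ?_⟩
    rw [pow_add]; group
  have PK : ∀ k' ∈ K, ∀ g, P g → P (k' * g) := by
    rintro k' hk' g ⟨n, k, hk, rfl⟩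
    refine ⟨n, (mu9 ^ n)⁻¹ * k' * mu9 ^ n * k, K.mul_mem (hconj'_pow n k' hk') hk, ?_⟩
    group
  have PKinv : ∀ k' ∈ K, ∀ g, P g → P (k'⁻¹ * g) := fun k' hk' g hg => PK _ (K.inv_mem hk') g hg
  -- closure under the three Tietze generators `a₀ = yμ`, `a₈ = (xy⁻¹z⁻¹)μ`, `a₉ = μ` and their inverses
  have hw8 : xI * yI⁻¹ * zI⁻¹ ∈ K := K.mul_mem (K.mul_mem hx (K.inv_mem hy)) (K.inv_mem hz)
  have Pall : ∀ g ∈ Subgroup.closure ({g17 0, g17 8, g17 9} : Set G17), P g := by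
    intro g hg
    refine Subgroup.closure_induction_left (p := fun g _ => P g) P1 ?_ ?_ hg
    · rintro a ha g - hPg
      simp only [Set.mem_insert_iff, Set.mem_singleton_iff] at ha
      rcases ha with rfl | rfl | rfl
      · rw [h.arc0, mul_assoc]; exact PK _ hy _ (Pmu9 _ hPg)
      · rw [h.arc8, mul_assoc]; exact PK _ hw8 _ (Pmu9 _ hPg)
      · exact Pmu9 _ hPg
    · rintro a ha g - hPg
      simp only [Set.mem_insert_iff, Set.mem_singleton_iff] at ha
      rcases ha with rfl | rfl | rfl
      · rw [h.arc0, mul_inv_rev, mul_assoc]; exact Pmu9' _ (PKinv _ hy _ hPg)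
      · rw [h.arc8, mul_inv_rev, mul_assoc]; exact Pmu9' _ (PKinv _ hw8 _ hPg)
      · exact Pmu9' _ hPg
  -- `a₀, a₈, a₉` generate (`σ17` is onto)
  have htop : ∀ g : G17, g ∈ Subgroup.closure ({g17 0, g17 8, g17 9} : Set G17) := by
    intro g
    obtain ⟨b, rfl⟩ := σ17_surjective g
    have hgen : ∀ i : Fin 3, (PresentedGroup.of i : G17c) ∈
        (Subgroup.closure ({g17 0, g17 8, g17 9} : Set G17)).comap σ17 := by
      intro i
      rw [Subgroup.mem_comap, show σ17 (PresentedGroup.of i) = kept17 i from PresentedGroup.toGroup.of _]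
      apply Subgroup.subset_closure
      fin_cases i <;> simp [kept17]
    exact PresentedGroup.generated_by _ _ hgen b
  -- the surjection `Fin 17 × K → G17`, `(n, k) ↦ μⁿ k`
  let f : Fin 17 × K → G17 := fun p => mu9 ^ (p.1 : ℕ) * p.2
  have hf : Function.Surjective f := by
    intro g
    obtain ⟨n, k, hk, rfl⟩ := Pall g (htop g)
    refine ⟨(⟨n % 17, Nat.mod_lt _ (by norm_num)⟩, ⟨(mu9 ^ 17) ^ (n / 17) * k, K.mul_mem (K.pow_mem h17 _) hk⟩), ?_⟩
    show mu9 ^ (n % 17) * ((mu9 ^ 17) ^ (n / 17) * k) = mu9 ^ n * k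
    rw [← mul_assoc, ← pow_mul, ← pow_add, Nat.mod_add_div]
  haveI : Finite G17 := Finite.of_surjective f hf
  refine ⟨inferInstance, ?_⟩
  calc Nat.card G17 ≤ Nat.card (Fin 17 × K) := Nat.card_le_card_of_surjective f hf
    _ = 17 * Nat.card K := by rw [Nat.card_prod, Nat.card_eq_fintype_card, Fintype.card_fin]
    _ ≤ 17 * 120 := Nat.mul_le_mul_left _ hKcard

/-- **`|π₁(S³₁₇(P(-2,3,7)))| = 2040` and `ρ17` is an isomorphism**, given the nine identities. -/
theorem card_eq_and_bijective_of_nine (h : NineIdentities) : Nat.card G17 = 2040 ∧ Function.Bijective ρ17 := by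
  obtain ⟨hfin, hle⟩ := finite_and_card_of_nine h
  haveI := hfin
  exact ⟨le_antisymm hle le_card_G17, bijective_ρ17_of_card_le hle⟩

/-- The isomorphism `G17 ≃* ℤ/17 × SL(2,𝔽₅)`, given the nine identities. -/
noncomputable def mulEquivK17_of_nine (h : NineIdentities) : G17 ≃* K17 :=
  MulEquiv.ofBijective ρ17 (card_eq_and_bijective_of_nine h).2

/-- Conversely the nine identities follow from injectivity of `ρ17` (their images agree, `nine_ρ17`). -/
theorem nine_of_injective (h : Function.Injective ρ17) : NineIdentities := by
  obtain ⟨h1, h2, h3, h4, h5, h6, h7, h8, h9⟩ := nine_ρ17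
  refine ⟨h ?_, h ?_, h ?_, h ?_, h ?_, h ?_, h ?_, h ?_, h ?_⟩
  · simp only [map_mul, map_pow]; exact h1
  · simp only [map_mul, map_pow]; exact h2
  · simp only [map_mul, map_pow]; exact h3
  · simp only [map_mul, map_inv]; exact h4
  · simp only [map_mul, map_inv]; exact h5
  · simp only [map_mul, map_inv]; exact h6
  · simp only [map_mul, map_inv, map_pow]; exact h7
  · simp only [map_mul]; exact h8
  · simp only [map_mul, map_inv]; exact h9

/-- **The nine identities are exactly the content of the upper bound:** `ρ17` is an isomorphism iff they hold. -/
theorem bijective_ρ17_iff_nine : Function.Bijective ρ17 ↔ NineIdentities :=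
  ⟨fun h => nine_of_injective h.1, fun h => (card_eq_and_bijective_of_nine h).2⟩

end PretzelSurgery
end Summit.SmoothPoincare4.SmoothPoincare4.Theorems
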